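import Literature.Probability.RandomPlanarGeometry.SLEOnePointUpperEstimate
import Literature.Probability.RandomPlanarGeometry.SLESameSideLaw
import Literature.Probability.RandomPlanarGeometry.SLETransienceKappaLtFour
import Literature.Probability.RandomPlanarGeometry.SLEKappaFourAvoidance
import Literature.Probability.RandomPlanarGeometry.CritPercSLELocalityMartingaleProofs
import Mathlib.Analysis.SpecialFunctions.Trigonometric.Bounds
import Mathlib.Analysis.SpecialFunctions.Trigonometric.Inverse
import HarnessLib

/-!
# Proximity of the SLE_κ trace to a boundary point: `P[dist(x, γ) ≤ r x] ≤ C r^{8/κ-1}`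

Topic `Probability/RandomPlanarGeometry`; theorems (and three book-keeping abbreviations for a grid
of points on a semicircle). For `0 < κ < 8` with `HasSLETrace κ` and a boundary point `x > 0`,

  `P[dist(x, γ[0,∞)) ≤ r·x] ≤ C_κ r^{8/κ - 1}`   for `0 < r ≤ 1/4`

with the sharp **boundary exponent** `s_b = 8/κ - 1` (`measure_infDist_ofReal_sleTrace_le`). This
is T. Alberts, M. J. Kozdron, *Intersection probabilities for a chordal SLE path and a semicircle*,
Electron. Commun. Probab. 13 (2008), **Thm 3.2** (the upper half of their Thm 1.1 (a),
`P{γ[0,∞) ∩ ℋ(x; rx) ≠ ∅} ≍ r^{(8-κ)/κ}` for the open semicircle `ℋ(x; rx)`, `0 < r ≤ 1/3`) in the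
slightly stronger closed form `dist(x, γ) ≤ r x` (which also accounts for the trace meeting the real
segment `[x - rx, x + rx]` when `4 < κ < 8`), and it is the "`p(r) ≤ c r^{η'}`" input of
V. Beffara, *The dimension of the SLE curves*, Ann. Probab. 36 (2008), proof of Lemma 8 (i)
("Let `p(r)` be the probability that a chordal SLE_κ starting at `0` touches the circle `C(1, r)`
[...] `p(r)` is bounded above by `c r^{η'}` for some `η' > 0` [actually, the optimal value for `η'`
is the same as the boundary exponent `s_b = (8/κ) - 1`, but we will not need this]"), and of
Prop. 2.6 of G. F. Lawler, B. M. Werness, *Multi-point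
Green's functions for SLE and an estimate of Beffara*, Ann. Probab. 41 (2013) (crosscuts of
diameter `d` at `-1` are hit with probability `≤ c d^β`, `β = 8/κ - 1`).

Proof: Alberts–Kozdron's own argument for Thm 3.2 ("Our general strategy [...] will be to cover the
semicircle `ℋ(x; rx)` with a sequence of balls and then apply Proposition 3.1 [Beffara's one-point
estimate with its angular factor] to each ball"), with the real end points added. If
`dist(x, γ) ≤ ρ = r x ≤ x/4`, then by
continuity `γ` passes through a point `w` of the closed upper semicircle `|w - x| = 2ρ`
(`exists_norm_sub_eq_of_infDist_le`). Either `w` is one of the two real end points `x ± 2ρ`, or `w`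
lies within `ε_k = ρπ2^{-k}/4` of one of the grid points `z_{k,j,±} = x ± 2ρ cos θ_{k,j} + 2iρ sin θ_{k,j}`,
`θ_{k,j} = (π/2) 2^{-k} (1 + j/8)`, `k ≥ 1`, `j ≤ 8` (`SemicircleGrid.cover`; a Whitney-type
decomposition of the semicircle towards its end points). For the grid points the **sharp interior
one-point estimate with its angular factor** (`measure_infDist_sleTrace_le_sharp'`,
`SLEOnePointUpperEstimate`: `P[dist(z,γ) ≤ ε] ≤ C (ε/Im z)^{1-κ/8} Ĝ(Re z/Im z)` for
`ε ≤ Im z/2`, with `Ĝ(w) = (1+w²)^{-(8-κ)/(2κ)} ≤ (Im z/Re z)^{8/κ-1}`) costs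
`≤ C (4π r 2^{-k})^{8/κ-1}` each (`measure_infDist_gridPoint_le`), a convergent geometric series in
`k`. The real end points are never visited for `κ ≤ 4` (Rohde–Schramm Lemma 7.2:
`ae_ofReal_notMem_closure_range_sleTrace_of_lt_four`, `ae_ofReal_notMem_closure_range_sleTrace_four`),
and for `4 < κ < 8` visiting `w` forces the trace to meet `[w, w + ρ)`, i.e. `T_w ≠ T_{w+ρ}`
(`IsGeneratedByCurve.forall_notMem_range_of_swallowingTime_eq`), an event of probability
`(h(∞) - h(z₀))/(h(∞) - h(1)) ≤ C z₀^{1-8/κ}`, `z₀ = (w+ρ)/ρ ≥ 3/(4r)`, by the sharp same-side law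
(Rohde–Schramm Lemma 6.6, `measureReal_swallowingTime_eq_sameSide`) and the kernel bound
`K ≤ 2^{4/κ} u^{-8/κ}` (`sameSideKernel_le`) — `measureReal_ofReal_mem_range_sleTrace_le`.

## References

* V. Beffara, *The dimension of the SLE curves*, Ann. Probab. 36 (2008), proof of Lemma 8 (i).
  [Beffara2008]
* G. F. Lawler, B. M. Werness, *Multi-point Green's functions for SLE and an estimate of Beffara*,
  Ann. Probab. 41 (2013), arXiv:1011.3551, Prop. 2.6. [LawlerWerness2010]
* T. Alberts, M. J. Kozdron, *Intersection probabilities for a chordal SLE path and a semicircle*,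
  Electron. Commun. Probab. 13 (2008) 448–460, arXiv:0707.3163: Thm 1.1 (a), Prop. 3.1, Thm 3.2 and
  its proof (§3.1). [AlbertsKozdron2007]
* S. Rohde, O. Schramm, *Basic properties of SLE*, Ann. of Math. 161 (2005), Lemmas 6.6, 7.2.
  [RohdeSchramm2005]
-/

noncomputable section

open Set Filter MeasureTheory Metric
open _root_.Topology
open scoped NNReal ENNReal Real

namespace Literature.Probability.RandomPlanarGeometry

/-! ### A Whitney-type grid on the upper semicircle -/

namespace SemicircleGrid

/-- The grid angles `θ_{k,j} = (π/2) 2^{-k} (1 + j/8)`. [folklore] -/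
def angle (k j : ℕ) : ℝ := π / 2 * 2⁻¹ ^ k * (1 + j / 8)

/-- The grid points `x + s·R Real.cos θ_{k,j} + i R Real.sin θ_{k,j}` (`s = ±1`) on the semicircle of radius
`R` about the real point `x`. [folklore] -/
def point (x R : ℝ) (k j : ℕ) (s : ℝ) : ℂ :=
  ((x + s * (R * Real.cos (angle k j)) : ℝ) : ℂ) + ((R * Real.sin (angle k j) : ℝ) : ℂ) * Complex.I

/-- The radii `ε_k = R π 2^{-k}/8` of the covering discs. [folklore] -/
def radius (R : ℝ) (k : ℕ) : ℝ := R * π * 2⁻¹ ^ k / 8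

variable {k j : ℕ}

/-- `0 < θ_{k,j}`. [folklore] -/
theorem angle_pos (k j : ℕ) : 0 < angle k j := by
  unfold angle; positivity

/-- `(π/2) 2^{-k} ≤ θ_{k,j}`. [folklore] -/
theorem base_le_angle (k j : ℕ) : π / 2 * 2⁻¹ ^ k ≤ angle k j := by
  unfold angle
  have h : (1 : ℝ) ≤ 1 + j / 8 := by
    have : (0 : ℝ) ≤ j / 8 := by positivity
    linarith
  have h0 : 0 ≤ π / 2 * 2⁻¹ ^ k := by positivity
  nlinarith

/-- `θ_{k,j} ≤ π 2^{-k}` for `j ≤ 8`. [folklore] -/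
theorem angle_le (hj : j ≤ 8) (k : ℕ) : angle k j ≤ π * 2⁻¹ ^ k := by
  unfold angle
  have h : (1 : ℝ) + j / 8 ≤ 2 := by
    have : (j : ℝ) ≤ 8 := by exact_mod_cast hj
    linarith
  have h0 : 0 ≤ π / 2 * 2⁻¹ ^ k := by positivity
  nlinarith

/-- `θ_{k,j} ≤ π/2` for `k ≥ 1`, `j ≤ 8`. [folklore] -/
theorem angle_le_pi_div_two (hk : 1 ≤ k) (hj : j ≤ 8) : angle k j ≤ π / 2 := by
  have h1 : (2⁻¹ : ℝ) ^ k ≤ 2⁻¹ := by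
    calc (2⁻¹ : ℝ) ^ k ≤ 2⁻¹ ^ 1 := pow_le_pow_of_le_one (by norm_num) (by norm_num) hk
      _ = 2⁻¹ := pow_one _
  have := angle_le hj k
  nlinarith [Real.pi_pos]

/-- `2^{-k} ≤ Real.sin θ_{k,j}` for `k ≥ 1`, `j ≤ 8` (Jordan's inequality). [folklore] -/
theorem le_sin_angle (hk : 1 ≤ k) (hj : j ≤ 8) : (2⁻¹ : ℝ) ^ k ≤ Real.sin (angle k j) := by
  have h := Real.mul_le_sin (angle_pos k j).le (angle_le_pi_div_two hk hj)
  have hb := base_le_angle k j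
  have hπ : 0 < π := Real.pi_pos
  calc (2⁻¹ : ℝ) ^ k = 2 / π * (π / 2 * 2⁻¹ ^ k) := by field_simp
    _ ≤ 2 / π * angle k j := mul_le_mul_of_nonneg_left hb (by positivity)
    _ ≤ Real.sin (angle k j) := h

/-- `sin θ_{k,j} ≤ π 2^{-k}` for `j ≤ 8`. [folklore] -/
theorem sin_angle_le (hj : j ≤ 8) (k : ℕ) : Real.sin (angle k j) ≤ π * 2⁻¹ ^ k :=
  (Real.sin_le (angle_pos k j).le).trans (angle_le hj k)

/-- `0 < sin θ_{k,j}` for `k ≥ 1`, `j ≤ 8`. [folklore] -/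
theorem sin_angle_pos (hk : 1 ≤ k) (hj : j ≤ 8) : 0 < Real.sin (angle k j) :=
  lt_of_lt_of_le (by positivity) (le_sin_angle hk hj)

/-- `0 ≤ cos θ_{k,j}` for `k ≥ 1`, `j ≤ 8`. [folklore] -/
theorem cos_angle_nonneg (hk : 1 ≤ k) (hj : j ≤ 8) : 0 ≤ Real.cos (angle k j) :=
  Real.cos_nonneg_of_mem_Icc ⟨by linarith [angle_pos k j, Real.pi_pos], angle_le_pi_div_two hk hj⟩

/-- Real part of a grid point. [folklore] -/
@[simp] theorem point_re (x R : ℝ) (k j : ℕ) (s : ℝ) :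
    (point x R k j s).re = x + s * (R * Real.cos (angle k j)) := by
  simp only [point, Complex.add_re, Complex.ofReal_re, Complex.mul_re, Complex.ofReal_im,
    Complex.I_re, Complex.I_im]
  ring

/-- Imaginary part of a grid point. [folklore] -/
@[simp] theorem point_im (x R : ℝ) (k j : ℕ) (s : ℝ) : (point x R k j s).im = R * Real.sin (angle k j) := by
  simp only [point, Complex.add_im, Complex.ofReal_im, Complex.mul_im, Complex.ofReal_re,
    Complex.I_re, Complex.I_im]
  ring

/-- `0 < ε_k`. [folklore] -/
theorem radius_pos {R : ℝ} (hR : 0 < R) (k : ℕ) : 0 < radius R k := by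
  unfold radius; positivity

/-- **The covering discs fit**: `ε_k ≤ (1 - 1/2) Im z_{k,j,s}` (`π/8 ≤ 1/2`). [folklore] -/
theorem radius_le_half_im {R : ℝ} (hR : 0 < R) (hk : 1 ≤ k) (hj : j ≤ 8) (x : ℝ) (s : ℝ) :
    radius R k ≤ (1 - 1 / 2) * (point x R k j s).im := by
  rw [point_im, radius]
  have h := le_sin_angle hk hj
  have hπ : π ≤ 4 := Real.pi_le_four
  have h0 : 0 ≤ (2⁻¹ : ℝ) ^ k := by positivity
  have h1 : R * 2⁻¹ ^ k ≤ R * Real.sin (angle k j) := mul_le_mul_of_nonneg_left h hR.le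
  have h2 : R * π * 2⁻¹ ^ k ≤ R * 4 * 2⁻¹ ^ k :=
    mul_le_mul_of_nonneg_right (mul_le_mul_of_nonneg_left hπ hR.le) h0
  linarith

/-- **Re z_{k,j,s} ≥ x - R** for `s = ±1` (`k ≥ 1`, `j ≤ 8`). [folklore] -/
theorem sub_le_point_re {R : ℝ} (hR : 0 ≤ R) (hk : 1 ≤ k) (hj : j ≤ 8) (x : ℝ) {s : ℝ}
    (hs : s = 1 ∨ s = -1) : x - R ≤ (point x R k j s).re := by
  rw [point_re]
  have hc0 := cos_angle_nonneg hk hj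
  have hc1 := Real.cos_le_one (angle k j)
  rcases hs with rfl | rfl <;> nlinarith

/-- **The grid covers the open semicircle up to the radii `ε_k`, and the two real end points are
left over.** For `w` on the upper closed semicircle of radius `R > 0` about `x`:
`w = x + R`, or `w = x - R`, or `|w - z_{k,j,s}| ≤ ε_k` for some `k ≥ 1`, `j ≤ 8`, `s = ±1`.
[folklore] -/
theorem cover {x R : ℝ} (hR : 0 < R) {w : ℂ} (hw : ‖w - x‖ = R) (hw0 : 0 ≤ w.im) :
    w = ((x + R : ℝ) : ℂ) ∨ w = ((x - R : ℝ) : ℂ) ∨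
      ∃ k, 1 ≤ k ∧ ∃ j, j ≤ 8 ∧ ∃ s : ℝ, (s = 1 ∨ s = -1) ∧ ‖w - point x R k j s‖ ≤ radius R k := by
  -- polar decomposition of `w - x`
  set c : ℝ := (w - x).re / R with hc
  set d : ℝ := (w - x).im / R with hd
  have hre : (w - x).re = R * c := by rw [hc]; field_simp
  have him : (w - x).im = R * d := by rw [hd]; field_simp
  have hd0 : 0 ≤ d := by
    rw [hd]; refine div_nonneg ?_ hR.le
    simpa using hw0
  have hcd : c ^ 2 + d ^ 2 = 1 := by
    have h1 : ‖w - x‖ ^ 2 = (w - x).re ^ 2 + (w - x).im ^ 2 := by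
      rw [Complex.sq_norm, Complex.normSq_apply]; ring
    rw [hw, hre, him] at h1
    have hR2 : R ^ 2 ≠ 0 := by positivity
    apply mul_left_cancel₀ hR2
    linarith
  have hwx : w = ((x + R * c : ℝ) : ℂ) + ((R * d : ℝ) : ℂ) * Complex.I := by
    apply Complex.ext
    · have : (w - (x : ℂ)).re = w.re - x := by simp
      simp only [Complex.add_re, Complex.ofReal_re, Complex.mul_re, Complex.I_re, mul_zero,
        Complex.ofReal_im, Complex.I_im, mul_one, sub_self]
      linarith [hre]
    · have : (w - (x : ℂ)).im = w.im := by simp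
      simp only [Complex.add_im, Complex.ofReal_im, Complex.mul_im, Complex.ofReal_re, Complex.I_im,
        mul_one, Complex.I_re, mul_zero, add_zero, zero_add]
      linarith [him]
  rcases hd0.eq_or_lt with hd0' | hdpos
  · -- `d = 0`: a real end point
    have hc1 : c = 1 ∨ c = -1 := by
      have h2 : c ^ 2 = 1 := by rw [← hd0'] at hcd; simpa using hcd
      have h3 : (c - 1) * (c + 1) = 0 := by nlinarith
      rcases mul_eq_zero.mp h3 with h | h
      · exact Or.inl (by linarith)
      · exact Or.inr (by linarith)
    rcases hc1 with h1 | h1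
    · left
      rw [hwx, ← hd0', h1]; push_cast; ring
    · right; left
      rw [hwx, ← hd0', h1]; push_cast; ring
  · -- `d > 0`: an interior point of the semicircle
    right; right
    have hc1 : |c| < 1 := by
      rw [← sq_lt_one_iff_abs_lt_one]
      nlinarith
    have hc1' : |c| ≤ 1 := hc1.le
    set θ : ℝ := Real.arccos |c| with hθ
    have hθpos : 0 < θ := Real.arccos_pos.2 hc1
    have hθle : θ ≤ π / 2 := Real.arccos_le_pi_div_two.2 (abs_nonneg c)
    have hcosθ : Real.cos θ = |c| := Real.cos_arccos (by linarith [abs_nonneg c]) hc1'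
    have hsinθ : Real.sin θ = d := by
      rw [hθ, Real.sin_arccos]
      have : 1 - |c| ^ 2 = d ^ 2 := by rw [sq_abs]; linarith
      rw [this, Real.sqrt_sq hdpos.le]
    -- the sign
    set s : ℝ := if 0 ≤ c then 1 else -1 with hs
    have hs1 : s = 1 ∨ s = -1 := by
      rw [hs]; split_ifs
      · exact Or.inl rfl
      · exact Or.inr rfl
    have hsc : s * |c| = c := by
      rw [hs]; split_ifs with h
      · rw [abs_of_nonneg h, one_mul]
      · rw [abs_of_neg (not_le.mp h)]; ring
    -- locate `u = θ/(π/2) ∈ (0, 1]` dyadically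
    set u : ℝ := θ / (π / 2) with hu
    have hπ2 : 0 < π / 2 := by positivity
    have hu0 : 0 < u := div_pos hθpos hπ2
    have hu1 : u ≤ 1 := by rw [hu, div_le_one hπ2]; exact hθle
    obtain ⟨n, hn1, hn2⟩ := exists_nat_pow_near_of_lt_one hu0 hu1 (by norm_num : (0 : ℝ) < 2⁻¹)
      (by norm_num)
    set k : ℕ := n + 1 with hk
    have hk1 : 1 ≤ k := by omega
    -- `v = u 2^k ∈ (1, 2]`
    set v : ℝ := u * 2 ^ k with hv
    have h2k : (2⁻¹ : ℝ) ^ k * 2 ^ k = 1 := by rw [← mul_pow]; norm_num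
    have hv1 : 1 < v := by
      have : (2⁻¹ : ℝ) ^ k < u := by rw [hk]; exact hn1
      calc (1 : ℝ) = 2⁻¹ ^ k * 2 ^ k := h2k.symm
        _ < u * 2 ^ k := mul_lt_mul_of_pos_right this (by positivity)
    have hv2 : v ≤ 2 := by
      have h' : u ≤ 2⁻¹ ^ n := hn2
      calc v = u * 2 ^ k := rfl
        _ ≤ 2⁻¹ ^ n * 2 ^ k := mul_le_mul_of_nonneg_right h' (by positivity)
        _ = 2 := by rw [hk, pow_succ, ← mul_assoc, ← mul_pow]; norm_num
    -- `j = ⌊8 (v - 1)⌋`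
    set j : ℕ := ⌊8 * (v - 1)⌋₊ with hj
    have hj8 : j ≤ 8 := by
      rw [hj]
      refine Nat.floor_le_of_le ?_
      push_cast
      linarith
    have hjv : |v - (1 + j / 8)| ≤ 1 / 8 := by
      have h1 : (j : ℝ) ≤ 8 * (v - 1) := Nat.floor_le (by linarith)
      have h2 : 8 * (v - 1) < j + 1 := Nat.lt_floor_add_one _
      rw [abs_le]; constructor <;> linarith
    -- `|θ - θ_{k,j}| ≤ (π/2) 2^{-k}/8`
    have hθ' : θ = π / 2 * u := by rw [hu]; field_simp
    have huv : 2⁻¹ ^ k * v = u := by rw [hv, mul_left_comm, h2k, mul_one]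
    have hθu : θ = π / 2 * 2⁻¹ ^ k * v := by rw [mul_assoc, huv, hθ']
    have hdiff : |θ - angle k j| ≤ π / 2 * 2⁻¹ ^ k / 8 := by
      rw [hθu, angle, ← mul_sub, abs_mul, abs_of_pos (by positivity)]
      have h0 : 0 ≤ π / 2 * 2⁻¹ ^ k := by positivity
      calc π / 2 * 2⁻¹ ^ k * |v - (1 + j / 8)| ≤ π / 2 * 2⁻¹ ^ k * (1 / 8) :=
            mul_le_mul_of_nonneg_left hjv h0
        _ = π / 2 * 2⁻¹ ^ k / 8 := by ring
    refine ⟨k, hk1, j, hj8, s, hs1, ?_⟩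
    -- `w - z = A + i B`, `A = R s (cos θ - cos θ')`, `B = R (sin θ - sin θ')`
    set A : ℝ := R * (s * (Real.cos θ - Real.cos (angle k j))) with hA
    set B : ℝ := R * (Real.sin θ - Real.sin (angle k j)) with hB
    have hcθ : R * c = R * (s * Real.cos θ) := by rw [hcosθ, hsc]
    have hwz : w - point x R k j s = (A : ℂ) + (B : ℂ) * Complex.I := by
      rw [hwx, point, hcθ, ← hsinθ, hA, hB]
      push_cast
      ring
    rw [hwz]
    have hs_abs : |s| = 1 := by rcases hs1 with h | h <;> simp [h]
    have hA' : |A| ≤ R * |θ - angle k j| := by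
      rw [hA, abs_mul, abs_mul, hs_abs, one_mul, abs_of_pos hR]
      exact mul_le_mul_of_nonneg_left (Real.abs_cos_sub_cos_le _ _) hR.le
    have hB' : |B| ≤ R * |θ - angle k j| := by
      rw [hB, abs_mul, abs_of_pos hR]
      exact mul_le_mul_of_nonneg_left (Real.abs_sin_sub_sin_le _ _) hR.le
    calc ‖(A : ℂ) + (B : ℂ) * Complex.I‖ ≤ ‖(A : ℂ)‖ + ‖(B : ℂ) * Complex.I‖ := norm_add_le _ _
      _ = |A| + |B| := by
          rw [norm_mul, Complex.norm_I, mul_one, Complex.norm_real, Complex.norm_real,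
            Real.norm_eq_abs, Real.norm_eq_abs]
      _ ≤ R * |θ - angle k j| + R * |θ - angle k j| := add_le_add hA' hB'
      _ ≤ R * (π / 2 * 2⁻¹ ^ k / 8) + R * (π / 2 * 2⁻¹ ^ k / 8) := by gcongr
      _ = radius R k := by rw [radius]; ring

end SemicircleGrid

open SemicircleGrid Literature.Probability.Process Loewner

/-! ### The crossing point -/

/-- **A path from `0` that comes within `ρ` of the real point `x > 2ρ` crosses the circle
`|w - x| = 2ρ`** (intermediate value theorem). [folklore] -/
theorem exists_norm_sub_eq_of_infDist_le {γ : ℝ≥0 → ℂ} (hγ : Continuous γ) (h0 : γ 0 = 0)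
    {x ρ : ℝ} (hρx : 2 * ρ < x) (hρ2 : ρ < 2 * ρ) (h : infDist (x : ℂ) (range γ) ≤ ρ) :
    ∃ s, ‖γ s - x‖ = 2 * ρ := by
  obtain ⟨_, ⟨t, rfl⟩, ht⟩ := (infDist_lt_iff (range_nonempty γ)).1 (h.trans_lt hρ2)
  set f : ℝ≥0 → ℝ := fun s ↦ ‖γ s - x‖ with hf
  have hfc : Continuous f := (hγ.sub continuous_const).norm
  have hf0 : f 0 = x := by
    simp only [hf, h0, zero_sub, norm_neg, Complex.norm_real, Real.norm_eq_abs]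
    exact abs_of_pos (by linarith)
  have hft : f t < 2 * ρ := by
    simp only [hf]
    rwa [dist_comm, dist_eq_norm] at ht
  have hmem : 2 * ρ ∈ Icc (f t) (f 0) := ⟨hft.le, by rw [hf0]; exact hρx.le⟩
  obtain ⟨s, _, hs⟩ := intermediate_value_Icc' bot_le hfc.continuousOn hmem
  exact ⟨s, hs⟩

variable {κ : ℝ≥0}

/-! ### The grid points: the sharp interior one-point estimate -/

/-- **`Ĝ ≤ (v/u)^{8/κ-1}`** at `w = u/v > 0` for the critical Rohde–Schramm profile
`Ĝ_{1-κ/8,κ}(w) = (1+w²)^{-(8-κ)/(2κ)}`, `κ ≤ 8`. [cite: RohdeSchramm2005, Lemma 6.3 (proof, p. 905)] -/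
theorem rsGhatSlope_critical_le_rpow (hκ : 0 < κ) (hκ8 : κ ≤ 8) {u v : ℝ} (hu : 0 < u) (hv : 0 < v) :
    rsGhatSlope (1 - (κ : ℝ) / 8) κ (u / v) ≤ (v / u) ^ (8 / (κ : ℝ) - 1) := by
  have hκ0 : (0 : ℝ) < κ := by exact_mod_cast hκ
  have hκ8' : (κ : ℝ) ≤ 8 := by exact_mod_cast hκ8
  set β : ℝ := 8 / (κ : ℝ) - 1 with hβ
  have hβ0 : 0 ≤ β := by
    have h8 : (1 : ℝ) ≤ 8 / κ := (one_le_div hκ0).2 hκ8'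
    rw [hβ]; linarith
  rw [rsGhatSlope_critical hκ0]
  have hw : 0 < u / v := div_pos hu hv
  have hexp : -((8 - (κ : ℝ)) / (2 * κ)) = -(β / 2) := by rw [hβ]; field_simp
  rw [hexp]
  calc (1 + (u / v) ^ 2) ^ (-(β / 2)) ≤ ((u / v) ^ 2) ^ (-(β / 2)) :=
        Real.rpow_le_rpow_of_nonpos (by positivity) (by linarith [sq_nonneg (u / v)]) (by linarith)
    _ = (v / u) ^ β := by
        rw [← Real.rpow_natCast, ← Real.rpow_mul hw.le]
        push_cast
        rw [show (2 : ℝ) * -(β / 2) = -β by ring, Real.rpow_neg hw.le, ← Real.inv_rpow hw.le,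
          inv_div]

/-- **One grid point.** For `0 < κ < 8` with `HasSLETrace κ` there is `C ≥ 0` such that for
`x ≥ 4ρ > 0`, `k ≥ 1`, `j ≤ 8`, `s = ±1`,
`P[dist(z_{k,j,s}, γ) ≤ ε_k] ≤ C (4π (ρ/x) 2^{-k})^{8/κ-1}` (grid of radius `2ρ` about `x`): the
sharp interior one-point estimate at `z = z_{k,j,s}` with `ε_k ≤ Im z/2` and
`Ĝ(Re z/Im z) ≤ (Im z/Re z)^{8/κ-1}`, `Im z ≤ 2πρ 2^{-k}`, `Re z ≥ x/2` (Alberts–Kozdron, proof of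
Thm 3.2: "Using Proposition 3.1, it follows that `P{γ ∩ B(z_{±n}; Im z_{±n}/2) ≠ ∅} ≍ [...]
r^{4a-1}/2^{(4a-1)|n|}`"). [cite: AlbertsKozdron2007, Thm 3.2 (proof)] -/
theorem measure_infDist_gridPoint_le (hκ : 0 < κ) (hκ8 : κ < 8) (hT : HasSLETrace κ) :
    ∃ C : ℝ, 0 ≤ C ∧ ∀ {x ρ : ℝ}, 0 < ρ → 4 * ρ ≤ x → ∀ {k j : ℕ}, 1 ≤ k → j ≤ 8 → ∀ {s : ℝ},
      (s = 1 ∨ s = -1) →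
      preWienerMeasure {ω | infDist (point x (2 * ρ) k j s) (range (sleTrace κ ω)) ≤ radius (2 * ρ) k} ≤
        ENNReal.ofReal (C * (4 * π * (ρ / x) * 2⁻¹ ^ k) ^ (8 / (κ : ℝ) - 1)) := by
  obtain ⟨C, hC⟩ := measure_infDist_sleTrace_le_sharp' hκ hκ8 hT (η := 1 / 2) (by norm_num)
    (by norm_num)
  have hκ0 : (0 : ℝ) < κ := by exact_mod_cast hκ
  have hκ8' : (κ : ℝ) < 8 := by exact_mod_cast hκ8
  set a : ℝ := 1 - (κ : ℝ) / 8 with ha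
  set β : ℝ := 8 / (κ : ℝ) - 1 with hβ
  have ha0 : 0 < a := by rw [ha]; linarith
  have hβ0 : 0 < β := by
    have h8 : (1 : ℝ) < 8 / κ := (one_lt_div hκ0).2 hκ8'
    rw [hβ]; linarith
  refine ⟨max C 0, le_max_right _ _, fun {x ρ} hρ hρx {k j} hk hj {s} hs ↦ ?_⟩
  set z : ℂ := point x (2 * ρ) k j s with hz
  set ε : ℝ := radius (2 * ρ) k with hε
  have hR : 0 < 2 * ρ := by linarith
  have hx : 0 < x := by linarith
  have hzim : 0 < z.im := by rw [hz, point_im]; exact mul_pos hR (sin_angle_pos hk hj)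
  have hε0 : 0 < ε := radius_pos hR k
  have hεim : ε ≤ (1 - 1 / 2) * z.im := radius_le_half_im hR hk hj x s
  refine (hC hzim hε0 hεim).trans (ENNReal.ofReal_le_ofReal ?_)
  -- `(ε/Im z)^a ≤ 1`
  have h1 : (ε / z.im) ^ a ≤ 1 :=
    Real.rpow_le_one (div_nonneg hε0.le hzim.le) (by rw [div_le_one hzim]; linarith) ha0.le
  -- `Ĝ ≤ (Im z/Re z)^β ≤ (4π (ρ/x) 2^{-k})^β`
  have hzre : x / 2 ≤ z.re := by
    have := sub_le_point_re hR.le hk hj x hs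
    rw [← hz] at this
    linarith
  have hzre0 : 0 < z.re := by linarith
  have hG : rsGhatSlope (1 - (κ : ℝ) / 8) κ (z.re / z.im) ≤ (z.im / z.re) ^ β :=
    rsGhatSlope_critical_le_rpow hκ hκ8.le hzre0 hzim
  have hratio : z.im / z.re ≤ 4 * π * (ρ / x) * 2⁻¹ ^ k := by
    rw [div_le_iff₀ hzre0]
    have him : z.im ≤ 2 * ρ * (π * 2⁻¹ ^ k) := by
      rw [hz, point_im]; exact mul_le_mul_of_nonneg_left (sin_angle_le hj k) hR.le
    calc z.im ≤ 2 * ρ * (π * 2⁻¹ ^ k) := him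
      _ = 4 * π * (ρ / x) * 2⁻¹ ^ k * (x / 2) := by field_simp; ring
      _ ≤ 4 * π * (ρ / x) * 2⁻¹ ^ k * z.re := mul_le_mul_of_nonneg_left hzre (by positivity)
  have hG' : rsGhatSlope (1 - (κ : ℝ) / 8) κ (z.re / z.im) ≤ (4 * π * (ρ / x) * 2⁻¹ ^ k) ^ β :=
    hG.trans (Real.rpow_le_rpow (div_nonneg hzim.le hzre0.le) hratio hβ0.le)
  have hGnn : 0 ≤ rsGhatSlope (1 - (κ : ℝ) / 8) κ (z.re / z.im) :=
    (rsGhatSlope_critical_mem_Ioc hκ0 hκ8'.le _).1.le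
  have hpow0 : 0 ≤ (ε / z.im) ^ a := Real.rpow_nonneg (div_nonneg hε0.le hzim.le) _
  calc C * (ε / z.im) ^ a * rsGhatSlope (1 - (κ : ℝ) / 8) κ (z.re / z.im)
      ≤ max C 0 * (ε / z.im) ^ a * rsGhatSlope (1 - (κ : ℝ) / 8) κ (z.re / z.im) :=
        mul_le_mul_of_nonneg_right (mul_le_mul_of_nonneg_right (le_max_left C 0) hpow0) hGnn
    _ ≤ max C 0 * 1 * (4 * π * (ρ / x) * 2⁻¹ ^ k) ^ β :=
        mul_le_mul (mul_le_mul_of_nonneg_left h1 (le_max_right _ _)) hG' hGnn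
          (mul_nonneg (le_max_right _ _) zero_le_one)
    _ = max C 0 * (4 * π * (ρ / x) * 2⁻¹ ^ k) ^ β := by ring


/-! ### The real end points -/

/-- **Tail of the same-side scale function**: `h(∞) - h(z) ≤ 2^{2a} z^{1-4a}/(4a-1)` for `z ≥ 2`,
`a > 1/4` (from `K_a(u) ≤ 2^{2a} u^{-4a}`, `sameSideKernel_le`). [cite: RohdeSchramm2005, Lemma 6.6] -/
theorem sameSideHTop_sub_sameSideH_le {a : ℝ} (ha : 1 / 4 < a) {z : ℝ} (hz : 2 ≤ z) :
    sameSideHTop a - sameSideH a z ≤ (2 : ℝ) ^ (2 * a) * z ^ (1 - 4 * a) / (4 * a - 1) := by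
  have ha0 : 0 ≤ a := by linarith
  have h4a : 0 < 4 * a - 1 := by linarith
  have hz1 : 1 < z := by linarith
  set e : ℝ := 1 - 4 * a with he
  have hneg : e < 0 := by rw [he]; linarith
  set M : ℝ := (2 : ℝ) ^ (2 * a) * z ^ e / (4 * a - 1) with hM
  have hbound : ∀ Z, z ≤ Z → sameSideH a Z - sameSideH a z ≤ M := by
    intro Z hZ
    have hZ1 : 1 < Z := by linarith
    have h0 : (0 : ℝ) ∉ Set.uIcc z Z := by
      rw [Set.uIcc_of_le hZ]; exact fun h ↦ by linarith [h.1]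
    rw [sameSideH_sub a hz1 hZ1]
    have hmono : ∫ u in z..Z, sameSideKernel a u ≤ ∫ u in z..Z, (2 : ℝ) ^ (2 * a) * u ^ (-(4 * a)) :=
      intervalIntegral.integral_mono_on hZ (intervalIntegrable_sameSideKernel a hz1 hZ1)
        ((intervalIntegral.intervalIntegrable_rpow (Or.inr h0)).const_mul _)
        fun u hu ↦ sameSideKernel_le ha0 (by linarith [hu.1])
    refine hmono.trans ?_
    rw [intervalIntegral.integral_const_mul, integral_rpow (Or.inr ⟨ne_of_lt (by linarith), h0⟩)]
    have h1 : -(4 * a) + 1 = e := by rw [he]; ring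
    rw [h1]
    have hZpow : 0 ≤ Z ^ e := Real.rpow_nonneg (by linarith) _
    have h2 : (Z ^ e - z ^ e) / e = (z ^ e - Z ^ e) / (4 * a - 1) := by
      rw [div_eq_div_iff hneg.ne h4a.ne', he]; ring
    rw [h2, hM, mul_div_assoc]
    refine mul_le_mul_of_nonneg_left (div_le_div_of_nonneg_right (by linarith) h4a.le) (by positivity)
  have hlim : Tendsto (fun Z ↦ sameSideH a Z - sameSideH a z) atTop
      (𝓝 (sameSideHTop a - sameSideH a z)) := (tendsto_sameSideH_atTop ha).sub_const _
  exact le_of_tendsto hlim ((eventually_ge_atTop z).mono hbound)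

/-- **Visiting a positive real point, `4 < κ < 8`.** With `HasSLETrace κ` there is `C ≥ 0` such that
for `0 < ρ ≤ w`: `P[w ∈ γ[0,∞)] ≤ C (ρ/w)^{8/κ-1}`. Indeed `w ∈ γ` forces a point of `[w, w+ρ)` on
the trace, i.e. `T_w ≠ T_{w+ρ}` (`IsGeneratedByCurve.forall_notMem_range_of_swallowingTime_eq`), of
probability `1 - P[T_w = T_{w+ρ}] = (h(∞) - h(z₀))/(h(∞) - h(1))`, `z₀ = (w+ρ)/ρ`, by the sharp
same-side law (Rohde–Schramm (2005), Lemma 6.6, `measureReal_swallowingTime_eq_sameSide`), and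
`h(∞) - h(z₀) ≤ 2^{4/κ} z₀^{1-8/κ}/(8/κ-1)`. [cite: RohdeSchramm2005, Lemma 6.6] -/
theorem measureReal_ofReal_mem_range_sleTrace_le (hκ4 : 4 < κ) (hκ8 : κ < 8) (hT : HasSLETrace κ) :
    ∃ C : ℝ, 0 ≤ C ∧ ∀ {w ρ : ℝ}, 0 < ρ → ρ ≤ w →
      preWienerMeasure.real {ω | ((w : ℝ) : ℂ) ∈ range (sleTrace κ ω)} ≤
        C * (ρ / w) ^ (8 / (κ : ℝ) - 1) := by
  haveI := isProbabilityMeasure_preWienerMeasure'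
  have hκ0 : (0 : ℝ) < κ := by exact_mod_cast lt_trans (by norm_num) hκ4
  have hκ4' : (4 : ℝ) < κ := by exact_mod_cast hκ4
  have hκ8' : (κ : ℝ) < 8 := by exact_mod_cast hκ8
  set a : ℝ := 2 / (κ : ℝ) with ha
  have ha4 : 1 / 4 < a := by rw [ha, div_lt_div_iff₀ (by norm_num) hκ0]; linarith
  have ha2 : a < 1 / 2 := by rw [ha, div_lt_div_iff₀ hκ0 (by norm_num)]; linarith
  have h4a : 0 < 4 * a - 1 := by linarith
  have hβa : 8 / (κ : ℝ) - 1 = 4 * a - 1 := by rw [ha]; ring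
  set D : ℝ := sameSideHTop a - sameSideH a 1 with hD
  have hD0 : 0 < D := sub_pos.2 (sameSideH_one_lt_sameSideHTop ha4 ha2)
  set C : ℝ := (2 : ℝ) ^ (2 * a) / ((4 * a - 1) * D) with hC
  have hC0 : 0 ≤ C := by positivity
  refine ⟨C, hC0, fun {w ρ} hρ hρw ↦ ?_⟩
  have hw : 0 < w := hρ.trans_le hρw
  set v : ℝ := w + ρ with hv
  have hwv : w < v := by rw [hv]; linarith
  have hv0 : v ≠ 0 := by positivity
  have hle : ∀ ω : ℝ≥0 → ℝ, swallowingTime (sleDriving κ ω) w ≤ swallowingTime (sleDriving κ ω) v :=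
    fun ω ↦ swallowingTime_mono_right (continuous_sleDriving κ ω)
      (by rw [sleDriving_zero]; exact hw) hwv.le
  -- a.e. `{w ∈ γ} ⊆ {T_w < T_v}`
  have hincl : {ω | ((w : ℝ) : ℂ) ∈ range (sleTrace κ ω)} ≤ᵐ[preWienerMeasure]
      {ω | swallowingTime (sleDriving κ ω) w < swallowingTime (sleDriving κ ω) v} := by
    filter_upwards [hT] with ω hG
    intro hmem
    refine lt_of_le_of_ne (hle ω) fun heq ↦ ?_
    exact (Loewner.isGeneratedByCurve_trace hG).forall_notMem_range_of_swallowingTime_eq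
      (continuous_sleDriving κ ω) (sleDriving_zero κ ω) hw heq w le_rfl hwv hmem
  have hmeas : MeasurableSet
      {ω | swallowingTime (sleDriving κ ω) w < swallowingTime (sleDriving κ ω) v} :=
    measurableSet_sle_swallowingTime_lt_swallowingTime κ hw.ne' hv0
  have hcompl : {ω | swallowingTime (sleDriving κ ω) w < swallowingTime (sleDriving κ ω) v} =
      {ω | swallowingTime (sleDriving κ ω) w = swallowingTime (sleDriving κ ω) v}ᶜ := by
    ext ω
    simp only [mem_setOf_eq, mem_compl_iff]
    exact ⟨fun h ↦ h.ne, fun h ↦ lt_of_le_of_ne (hle ω) h⟩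
  have hmeasEq : MeasurableSet
      {ω | swallowingTime (sleDriving κ ω) w = swallowingTime (sleDriving κ ω) v} := by
    rw [← MeasurableSet.compl_iff, ← hcompl]; exact hmeas
  -- the same-side law
  set z₀ : ℝ := v / (v - w) with hz₀
  have hz₀' : z₀ = (w + ρ) / ρ := by rw [hz₀, hv, add_sub_cancel_left]
  have hz₀2 : 2 ≤ z₀ := by
    rw [hz₀', le_div_iff₀ hρ]; linarith
  have hlaw := measureReal_swallowingTime_eq_sameSide hκ4 hκ8 hw hwv
  rw [← ha] at hlaw
  calc preWienerMeasure.real {ω | ((w : ℝ) : ℂ) ∈ range (sleTrace κ ω)}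
      ≤ preWienerMeasure.real
          {ω | swallowingTime (sleDriving κ ω) w < swallowingTime (sleDriving κ ω) v} := by
        simp only [measureReal_def]
        exact ENNReal.toReal_mono (measure_ne_top _ _) (measure_mono_ae hincl)
    _ = 1 - preWienerMeasure.real
          {ω | swallowingTime (sleDriving κ ω) w = swallowingTime (sleDriving κ ω) v} := by
        rw [hcompl, probReal_compl_eq_one_sub hmeasEq]
    _ = (sameSideHTop a - sameSideH a z₀) / D := by
        have hD0' : sameSideHTop a - sameSideH a 1 ≠ 0 := by rw [← hD]; exact hD0.ne'
        rw [← hz₀] at hlaw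
        rw [hlaw, hD, eq_div_iff hD0', sub_mul, div_mul_cancel₀ _ hD0']
        ring
    _ ≤ ((2 : ℝ) ^ (2 * a) * z₀ ^ (1 - 4 * a) / (4 * a - 1)) / D :=
        div_le_div_of_nonneg_right (sameSideHTop_sub_sameSideH_le ha4 hz₀2) hD0.le
    _ = C * z₀ ^ (1 - 4 * a) := by rw [hC]; field_simp
    _ ≤ C * (ρ / w) ^ (8 / (κ : ℝ) - 1) := by
        refine mul_le_mul_of_nonneg_left ?_ hC0
        have hwρ : 0 < w / ρ := div_pos hw hρ
        have h1 : z₀ ^ (1 - 4 * a) ≤ (w / ρ) ^ (1 - 4 * a) :=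
          Real.rpow_le_rpow_of_nonpos hwρ
            (by rw [hz₀']; exact div_le_div_of_nonneg_right (by linarith) hρ.le) (by linarith)
        refine h1.trans_eq ?_
        rw [hβa, show (1 : ℝ) - 4 * a = -(4 * a - 1) by ring, Real.rpow_neg hwρ.le,
          ← Real.inv_rpow hwρ.le, inv_div]

/-- **Visiting a real point, `κ ≤ 4`**: `P[w ∈ γ[0,∞)] = 0` for `w ≠ 0` (Rohde–Schramm (2005),
Lemma 7.2: `w ∉ cl γ[0,∞)` a.s.; tree: `ae_ofReal_notMem_closure_range_sleTrace_of_lt_four`,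
`ae_ofReal_notMem_closure_range_sleTrace_four`). [cite: RohdeSchramm2005, Lemma 7.2] -/
theorem measure_ofReal_mem_range_sleTrace_eq_zero (hκ : 0 < κ) (hκ4 : κ ≤ 4) (hT : HasSLETrace κ)
    {w : ℝ} (hw : w ≠ 0) : preWienerMeasure {ω | ((w : ℝ) : ℂ) ∈ range (sleTrace κ ω)} = 0 := by
  have hae : ∀ᵐ ω ∂preWienerMeasure, ((w : ℝ) : ℂ) ∉ closure (range (sleTrace κ ω)) := by
    rcases hκ4.lt_or_eq with h | h
    · exact ae_ofReal_notMem_closure_range_sleTrace_of_lt_four hκ h hT hw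
    · subst h
      exact ae_ofReal_notMem_closure_range_sleTrace_four hT hw
  refine measure_mono_null (fun ω hω ↦ ?_) (ae_iff.1 hae)
  simp only [mem_setOf_eq, not_not]
  exact subset_closure hω

/-! ### Assembly -/

/-- **Proximity of the SLE_κ trace to a boundary point** (Alberts–Kozdron (2008), Thm 3.2, closed
form; `0 < κ < 8`, `HasSLETrace κ`): there is `C = C_κ ≥ 0` such that for every `x > 0` and
`0 < r ≤ 1/4`, `P[dist(x, γ[0,∞)) ≤ r x] ≤ C r^{8/κ - 1}` — the boundary exponent `s_b = 8/κ - 1`;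
this is also Beffara's `p(r) ≤ c r^{η'}` (proof of Lemma 8 (i)) and Lawler–Werness's Prop. 2.6.
Proof as in Alberts–Kozdron §3.1: a Whitney-type grid on the semicircle of radius `2rx`
(`SemicircleGrid.cover`), the sharp interior one-point estimate at the grid points
(`measure_infDist_gridPoint_le`, a geometric series in the level `k`), plus the two real end points
(`measureReal_ofReal_mem_range_sleTrace_le`, `measure_ofReal_mem_range_sleTrace_eq_zero`).
[cite: AlbertsKozdron2007, Thm 3.2] [cite: Beffara2008, proof of Lemma 8 (i)]
[cite: LawlerWerness2010, Prop. 2.6] -/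
theorem measure_infDist_ofReal_sleTrace_le (hκ : 0 < κ) (hκ8 : κ < 8) (hT : HasSLETrace κ) :
    ∃ C : ℝ, 0 ≤ C ∧ ∀ {x : ℝ}, 0 < x → ∀ {r : ℝ}, 0 < r → r ≤ 1 / 4 →
      preWienerMeasure {ω | infDist (x : ℂ) (range (sleTrace κ ω)) ≤ r * x} ≤
        ENNReal.ofReal (C * r ^ (8 / (κ : ℝ) - 1)) := by
  haveI := isProbabilityMeasure_preWienerMeasure'
  have hκ0 : (0 : ℝ) < κ := by exact_mod_cast hκ
  have hκ8' : (κ : ℝ) < 8 := by exact_mod_cast hκ8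
  set β : ℝ := 8 / (κ : ℝ) - 1 with hβ
  have hβ0 : 0 < β := by
    have h8 : (1 : ℝ) < 8 / κ := (one_lt_div hκ0).2 hκ8'
    rw [hβ]; linarith
  obtain ⟨C₁, hC₁0, hgrid⟩ := measure_infDist_gridPoint_le hκ hκ8 hT
  -- the real end points
  obtain ⟨C₂, hC₂0, hend⟩ : ∃ C₂ : ℝ, 0 ≤ C₂ ∧ ∀ {w ρ : ℝ}, 0 < ρ → ρ ≤ w →
      preWienerMeasure {ω | ((w : ℝ) : ℂ) ∈ range (sleTrace κ ω)} ≤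
        ENNReal.ofReal (C₂ * (ρ / w) ^ β) := by
    by_cases h4 : κ ≤ 4
    · refine ⟨0, le_rfl, fun {w ρ} hρ hρw ↦ ?_⟩
      rw [measure_ofReal_mem_range_sleTrace_eq_zero hκ h4 hT (hρ.trans_le hρw).ne']
      exact bot_le
    · rw [not_le] at h4
      obtain ⟨C₂, hC₂0, h⟩ := measureReal_ofReal_mem_range_sleTrace_le h4 hκ8 hT
      refine ⟨C₂, hC₂0, fun {w ρ} hρ hρw ↦ ?_⟩
      rw [← ofReal_measureReal (measure_ne_top _ _)]
      exact ENNReal.ofReal_le_ofReal (h hρ hρw)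
  -- constants
  set q : ℝ := (2⁻¹ : ℝ) ^ β with hq
  have hq0 : 0 < q := Real.rpow_pos_of_pos (by norm_num) _
  have hq1 : q < 1 := Real.rpow_lt_one (by norm_num) (by norm_num) hβ0
  set M : ℝ := C₁ * (4 * π) ^ β with hM
  have hM0 : 0 ≤ M := by positivity
  set C : ℝ := C₂ + C₂ * 2 ^ β + 18 * M * (q / (1 - q)) with hC
  have hC0 : 0 ≤ C := by
    have : 0 ≤ q / (1 - q) := div_nonneg hq0.le (by linarith)
    positivity
  refine ⟨C, hC0, fun {x} hx {r} hr hr4 ↦ ?_⟩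
  set ρ : ℝ := r * x with hρ
  have hρ0 : 0 < ρ := mul_pos hr hx
  have hρx : 4 * ρ ≤ x := by rw [hρ]; nlinarith
  have hρr : ρ / x = r := by rw [hρ]; field_simp
  -- the events
  set Ep : Set (ℝ≥0 → ℝ) := {ω | (((x + 2 * ρ : ℝ)) : ℂ) ∈ range (sleTrace κ ω)} with hEp
  set Em : Set (ℝ≥0 → ℝ) := {ω | (((x - 2 * ρ : ℝ)) : ℂ) ∈ range (sleTrace κ ω)} with hEm
  set G : ℕ → Fin 9 → Bool → Set (ℝ≥0 → ℝ) := fun k j b ↦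
    {ω | infDist (point x (2 * ρ) (k + 1) j (if b then 1 else -1)) (range (sleTrace κ ω)) ≤
      radius (2 * ρ) (k + 1)} with hG
  have hsub : {ω | infDist (x : ℂ) (range (sleTrace κ ω)) ≤ r * x} ⊆
      (Ep ∪ Em) ∪ ⋃ k, ⋃ j, ⋃ b, G k j b := by
    intro ω hω
    -- `γ(0) = W₀ = 0` (the tree's `sleTrace_zero`, `ConformalRestrictionProofs`, inlined to keep the
    -- import closure small)
    have h0 : sleTrace κ ω 0 = 0 := by
      change Loewner.trace (sleDriving κ ω) 0 = 0
      rw [Loewner.trace_zero, sleDriving_zero, Complex.ofReal_zero]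
    obtain ⟨s, hs⟩ := exists_norm_sub_eq_of_infDist_le (continuous_sleTrace κ ω) h0
      (by linarith : 2 * ρ < x) (by linarith : ρ < 2 * ρ) hω
    rcases cover (by linarith : 0 < 2 * ρ) hs (Loewner.trace_im_nonneg (sleDriving κ ω) s) with
      h | h | ⟨k, hk, j, hj, s', hs', hdist⟩
    · exact Or.inl (Or.inl ⟨s, h⟩)
    · exact Or.inl (Or.inr ⟨s, h⟩)
    · refine Or.inr ?_
      simp only [mem_iUnion]
      have hk' : k - 1 + 1 = k := Nat.sub_add_cancel hk
      have hinf : infDist (point x (2 * ρ) k j s') (range (sleTrace κ ω)) ≤ radius (2 * ρ) k :=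
        calc infDist (point x (2 * ρ) k j s') (range (sleTrace κ ω))
            ≤ dist (point x (2 * ρ) k j s') (sleTrace κ ω s) := infDist_le_dist_of_mem (mem_range_self s)
          _ = ‖sleTrace κ ω s - point x (2 * ρ) k j s'‖ := by rw [dist_comm, dist_eq_norm]
          _ ≤ radius (2 * ρ) k := hdist
      rcases hs' with rfl | rfl
      · refine ⟨k - 1, ⟨j, by omega⟩, true, ?_⟩
        simp only [hG, mem_setOf_eq, if_true, hk']
        exact hinf
      · refine ⟨k - 1, ⟨j, by omega⟩, false, ?_⟩
        simp only [hG, mem_setOf_eq, hk']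
        exact hinf
  -- the level-`k` bound
  have hlevel : ∀ k : ℕ, preWienerMeasure (⋃ j, ⋃ b, G k j b) ≤
      ENNReal.ofReal (18 * M * r ^ β * (q * q ^ k)) := by
    intro k
    have hterm : ∀ (j : Fin 9) (b : Bool), preWienerMeasure (G k j b) ≤
        ENNReal.ofReal (M * r ^ β * (q * q ^ k)) := by
      intro j b
      have hs : (if b then (1 : ℝ) else -1) = 1 ∨ (if b then (1 : ℝ) else -1) = -1 := by
        cases b <;> simp
      refine (hgrid hρ0 hρx (Nat.succ_le_succ (Nat.zero_le k)) (by have := j.isLt; omega) hs).trans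
        (le_of_eq ?_)
      congr 1
      rw [hρr, hM, hq, Real.mul_rpow (by positivity) (by positivity),
        Real.mul_rpow (by positivity) (by positivity)]
      have hpow : ((2⁻¹ : ℝ) ^ (k + 1)) ^ β = (2⁻¹ : ℝ) ^ β * ((2⁻¹ : ℝ) ^ β) ^ k := by
        rw [← Real.rpow_natCast, ← Real.rpow_mul (by norm_num), mul_comm, Real.rpow_mul (by norm_num),
          Real.rpow_natCast, pow_succ']
      rw [hpow]
      ring
    calc preWienerMeasure (⋃ j, ⋃ b, G k j b) ≤ ∑ j, preWienerMeasure (⋃ b, G k j b) :=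
          measure_iUnion_fintype_le _ _
      _ ≤ ∑ j : Fin 9, ∑ b : Bool, preWienerMeasure (G k j b) :=
          Finset.sum_le_sum fun j _ ↦ measure_iUnion_fintype_le _ _
      _ ≤ ∑ _j : Fin 9, ∑ _b : Bool, ENNReal.ofReal (M * r ^ β * (q * q ^ k)) :=
          Finset.sum_le_sum fun j _ ↦ Finset.sum_le_sum fun b _ ↦ hterm j b
      _ = ENNReal.ofReal (18 * M * r ^ β * (q * q ^ k)) := by
          rw [Finset.sum_const, Finset.sum_const, Finset.card_univ, Finset.card_univ,
            Fintype.card_bool, Fintype.card_fin, smul_smul, nsmul_eq_mul,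
            show (18 : ℝ) * M * r ^ β * (q * q ^ k) = 18 * (M * r ^ β * (q * q ^ k)) by ring,
            ENNReal.ofReal_mul (show (0 : ℝ) ≤ 18 by norm_num), ENNReal.ofReal_ofNat]
          norm_num
  -- summing the levels
  have hsum : Summable fun k : ℕ ↦ 18 * M * r ^ β * (q * q ^ k) :=
    ((summable_geometric_of_lt_one hq0.le hq1).mul_left q).mul_left _
  have htsum : ∑' k : ℕ, 18 * M * r ^ β * (q * q ^ k) = 18 * M * r ^ β * (q / (1 - q)) := by
    rw [tsum_mul_left, tsum_mul_left, tsum_geometric_of_lt_one hq0.le hq1, div_eq_mul_inv]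
  have hnn : ∀ k : ℕ, 0 ≤ 18 * M * r ^ β * (q * q ^ k) := fun k ↦ by positivity
  -- the end points
  have hEp' : preWienerMeasure Ep ≤ ENNReal.ofReal (C₂ * r ^ β) := by
    refine (hend (w := x + 2 * ρ) hρ0 (by linarith)).trans (ENNReal.ofReal_le_ofReal ?_)
    refine mul_le_mul_of_nonneg_left (Real.rpow_le_rpow (by positivity) ?_ hβ0.le) hC₂0
    rw [← hρr]
    exact div_le_div_of_nonneg_left hρ0.le hx (by linarith)
  have hEm' : preWienerMeasure Em ≤ ENNReal.ofReal (C₂ * 2 ^ β * r ^ β) := by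
    refine (hend (w := x - 2 * ρ) hρ0 (by linarith)).trans (ENNReal.ofReal_le_ofReal ?_)
    rw [mul_assoc, ← Real.mul_rpow (by norm_num) hr.le]
    refine mul_le_mul_of_nonneg_left (Real.rpow_le_rpow (by
      exact div_nonneg hρ0.le (by linarith)) ?_ hβ0.le) hC₂0
    rw [div_le_iff₀ (by linarith : 0 < x - 2 * ρ), hρ]
    nlinarith
  calc preWienerMeasure {ω | infDist (x : ℂ) (range (sleTrace κ ω)) ≤ r * x}
      ≤ preWienerMeasure ((Ep ∪ Em) ∪ ⋃ k, ⋃ j, ⋃ b, G k j b) := measure_mono hsub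
    _ ≤ preWienerMeasure (Ep ∪ Em) + preWienerMeasure (⋃ k, ⋃ j, ⋃ b, G k j b) :=
        measure_union_le _ _
    _ ≤ preWienerMeasure Ep + preWienerMeasure Em + preWienerMeasure (⋃ k, ⋃ j, ⋃ b, G k j b) :=
        add_le_add (measure_union_le Ep Em) le_rfl
    _ ≤ ENNReal.ofReal (C₂ * r ^ β) + ENNReal.ofReal (C₂ * 2 ^ β * r ^ β) +
          ∑' k, ENNReal.ofReal (18 * M * r ^ β * (q * q ^ k)) := by
        gcongr
        exact (measure_iUnion_le _).trans (ENNReal.tsum_le_tsum hlevel)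
    _ = ENNReal.ofReal (C₂ * r ^ β + C₂ * 2 ^ β * r ^ β + 18 * M * r ^ β * (q / (1 - q))) := by
        rw [← ENNReal.ofReal_tsum_of_nonneg hnn hsum, htsum, ← ENNReal.ofReal_add (by positivity)
          (by positivity), ← ENNReal.ofReal_add (by positivity)]
        have : 0 ≤ q / (1 - q) := div_nonneg hq0.le (by linarith)
        positivity
    _ = ENNReal.ofReal (C * r ^ β) := by rw [hC]; ring_nf

end Literature.Probability.RandomPlanarGeometry
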